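import Literature.NumberTheory.EllipticCurves.ZpExtensionEisensteinGradedInvariantsVanishingProofs
import Literature.NumberTheory.EllipticCurves.ZpExtensionEisensteinTwistFixedPointBoundProofs
import Literature.NumberTheory.EllipticCurves.IwasawaAlgebraEisensteinUniformIndexProofs
import Literature.NumberTheory.GaloisRepresentations.OneCocycleRestrictionKernelCountProofs
import Literature.NumberTheory.EllipticCurves.TorsionFilAtAdaptedBasisProofs
import Literature.NumberTheory.EllipticCurves.ZpExtensionEisensteinOrdinaryFiltration
import Literature.NumberTheory.EllipticCurves.ZpExtensionEisensteinGradedInvariantsBoundProofs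
import Literature.NumberTheory.EllipticCurves.TorsionFilAtCountMultiplicativeThreeProofs
import HarnessLib

/-!
# Integer Galois scalars on `E[3^k]` modulo `Fil_v` and the graded-invariants count at a place `v ∣ 3` of MULTIPLICATIVE reduction
# (theorems only — no definition, no named fact, no instance, no `sorry`)

Topic `NumberTheory/EllipticCurves` (LEAD `bsd-wall-utd-p1`, crux r205 stmt-BirchSwinnertonDyer-24737 `TwinAlgMuZeroAtThree`,
line `beta-road`, stub `stub_howardOutputsOfFamily`, E2 assembly at `v ∣ 3`).  The two curve-level theorems of x9's
`ZpExtensionEisensteinGradedInvariantsBoundProofs` (`exists_int_scalar_torsionFilAt`,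
`finite_and_natCard_setOf_oneCocycleClass_quotient_torsionFilAt_principal_le_pow`) assume GOOD reduction with an ordinary point,
used only through the adapted basis `exists_addEquiv_mem_torsionFilAt_iff`; at places of MULTIPLICATIVE reduction above `3` that
basis is `TorsionFilAtCountMultiplicativeThreeProofs.exists_addEquiv_mem_torsionFilAt_iff_of_hasMultiplicativeReductionAt_three`.
This file: x9's two statements and proofs at `p = 3` with `(hgood, hord)` replaced by `hmult` (the generic §§ of x9's file are
imported, not restated).  BSD is not proved by any of this.

References: [Howard2004HeegnerKolyvagin] §3.1–3.2; [GreenbergLNM1716] §2; [SerreGaloisCohomology1997] I §2.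
-/

set_option autoImplicit false

noncomputable section

open Function NumberField IsDedekindDomain Field
open scoped NumberField TensorProduct ContRepresentation

namespace WeierstrassCurve

open Literature.NumberTheory.EllipticCurves Literature.NumberTheory.GaloisRepresentations
  IwasawaAlgebra IwasawaAlgebra.EisensteinCoeff

variable {K : Type} [Field K] [NumberField K] (V : WeierstrassCurve K) [V.IsElliptic]
  (κ : ZpExtension K 3) {m : ℕ} (hm : 1 ≤ m) (v : HeightOneSpectrum (𝓞 K))
  (t : ∀ k, (V.torsionGaloisModule (((3 : ℕ) : ℤ) ^ (k + 1))).toContRepresentation →ⁱL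
    (V.torsionGaloisModule (((3 : ℕ) : ℤ) ^ k)).toContRepresentation)
  (ht : ∀ k (P : geomTorsion V (((3 : ℕ) : ℤ) ^ (k + 1))), t k P = V.geomTorsionReduce 3 k P)

/-- **Every `σ₀ ∈ Γ_{K_v}` acts on `gr_v E[p^k] = E[p^k] / Fil_v E[p^k]` as an integer `n₀` prime to `p`, and `E[p^k] = ℤ Q₀ + Fil_v E[p^k]`**
(`k ≥ 1`, `v ∋ p` of good reduction with an ordinary point): from the adapted basis `e : E[p^k] ≃ (ℤ/p^k)²`, `Fil_v = {e(·)₁ = 0}`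
(`exists_addEquiv_mem_torsionFilAt_iff`) with the coordinate `π = e(·)₁` and `Q₀ = e⁻¹(0,1)`.
[cite: Howard2004HeegnerKolyvagin, §3.1 (arXiv:1202.6340 p. 15 L56–62) and Lemma 3.2.7] [cite: GreenbergLNM1716, §2 (the action on Ẽ[p^k])] -/
theorem exists_int_scalar_torsionFilAt_of_hasMultiplicativeReductionAt_three (hpv : ((3 : ℕ) : 𝓞 K) ∈ v.asIdeal) (hmult : V.HasMultiplicativeReductionAt v) {k : ℕ}
    (hk : 1 ≤ k) (σ₀ : absoluteGaloisGroup (v.adicCompletion K)) :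
    ∃ (n₀ : ℤ) (Q₀ : geomTorsion V (((3 : ℕ) : ℤ) ^ k)), ¬ ((3 : ℕ) : ℤ) ∣ n₀ ∧
      (∀ a, GaloisRep.toLocal v (V.torsionGaloisModule (((3 : ℕ) : ℤ) ^ k)) σ₀ a - n₀ • a ∈ V.torsionFilAt v (((3 : ℕ) : ℤ) ^ k)) ∧
      (∀ a, ∃ n : ℤ, a - n • Q₀ ∈ V.torsionFilAt v (((3 : ℕ) : ℤ) ^ k)) := by
  haveI : NeZero (3 ^ k) := ⟨pow_ne_zero k Nat.prime_three.ne_zero⟩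
  obtain ⟨e, he⟩ := V.exists_addEquiv_mem_torsionFilAt_iff_of_hasMultiplicativeReductionAt_three v hpv hmult hk
  -- the coordinate `π = e(·)₁`, its section `Q₀`
  let π : geomTorsion V (((3 : ℕ) : ℤ) ^ k) →+ ZMod (3 ^ k) :=
    (Pi.evalAddMonoidHom (fun _ : Fin 2 ↦ ZMod (3 ^ k)) 1).comp e.toAddMonoidHom
  have hπ : ∀ a, π a = e a 1 := fun _ ↦ rfl
  have hmem : ∀ a, a ∈ V.torsionFilAt v (((3 : ℕ) : ℤ) ^ k) ↔ π a = 0 := fun a ↦ by rw [hπ]; exact he a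
  let Q₀ : geomTorsion V (((3 : ℕ) : ℤ) ^ k) := e.symm (Pi.single 1 1)
  have hQ₀ : π Q₀ = 1 := by
    rw [hπ]
    change e (e.symm (Pi.single 1 1)) 1 = 1
    rw [AddEquiv.apply_symm_apply, Pi.single_eq_same]
  -- `σ₀` and `σ₀⁻¹` preserve `Fil_v`
  let g : geomTorsion V (((3 : ℕ) : ℤ) ^ k) →+ geomTorsion V (((3 : ℕ) : ℤ) ^ k) :=
    (GaloisRep.toLocal v (V.torsionGaloisModule (((3 : ℕ) : ℤ) ^ k)) σ₀).toAddMonoidHom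
  let g' : geomTorsion V (((3 : ℕ) : ℤ) ^ k) →+ geomTorsion V (((3 : ℕ) : ℤ) ^ k) :=
    (GaloisRep.toLocal v (V.torsionGaloisModule (((3 : ℕ) : ℤ) ^ k)) σ₀⁻¹).toAddMonoidHom
  have hg : ∀ a, g a = GaloisRep.toLocal v (V.torsionGaloisModule (((3 : ℕ) : ℤ) ^ k)) σ₀ a := fun _ ↦ rfl
  have hg' : ∀ a, g' a = GaloisRep.toLocal v (V.torsionGaloisModule (((3 : ℕ) : ℤ) ^ k)) σ₀⁻¹ a := fun _ ↦ rfl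
  have hgg' : ∀ a, g (g' a) = a := fun a ↦ by
    rw [hg, hg']
    change (GaloisRep.toLocal v (V.torsionGaloisModule (((3 : ℕ) : ℤ) ^ k)) σ₀ *
      GaloisRep.toLocal v (V.torsionGaloisModule (((3 : ℕ) : ℤ) ^ k)) σ₀⁻¹) a = a
    rw [← map_mul, mul_inv_cancel, map_one]
    rfl
  have hgFil : ∀ a, π a = 0 → π (g a) = 0 := fun a ha ↦
    (hmem _).1 (by rw [hg]; exact V.smul_mem_torsionFilAt v _ σ₀ a ((hmem a).2 ha))
  have hg'Fil : ∀ a, π a = 0 → π (g' a) = 0 := fun a ha ↦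
    (hmem _).1 (by rw [hg']; exact V.smul_mem_torsionFilAt v _ σ₀⁻¹ a ((hmem a).2 ha))
  obtain ⟨n₀, hn₀, hσ₀⟩ := exists_int_not_dvd_forall_apply_sub_zsmul hk π Q₀ hQ₀ g g' hgg' hgFil hg'Fil
  refine ⟨n₀, Q₀, hn₀, fun a ↦ (hmem _).2 (by rw [← hg]; exact hσ₀ a), fun a ↦ ?_⟩
  obtain ⟨n, hn⟩ := exists_sub_zsmul_mem_ker π Q₀ hQ₀ a
  exact ⟨n, (hmem _).2 hn⟩

/-- **The `m`-UNIFORM local count at `v ∣ p` for the curve.**  At a place `v ∋ p` of good reduction with an ordinary point, for the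
Eisenstein level `T = E[p^k] ⊗ A_{m,k}(ψ)` (`k ≥ 1`) with its ordinary filtration `Fil_v T = A_{m,k} ⊗ Fil_v E[p^k]` and any
`σ₀ ∈ Γ_{K_v}` with `κ(σ₀) = p^s`, `p^s < m`: the classes of `H¹(K_v, T / Fil_v T)` that are PRINCIPAL ON
`Gal(K̄_v/K_{∞,w}) = {σ | res σ ∈ ker κ}` form a finite set of order `≤ p^{p^s}` — independently of `k` and `m`.
(§5 with §7's scalar data.)  This bounds the graded half of the local defect at `v ∣ p` in the index clause (B5) of
Howard's readout at `𝔮 = T^m + p` (blueprint S1-DISCRETE §2, shared μ-crux stmt-BirchSwinnertonDyer-23428).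
[cite: Howard2004HeegnerKolyvagin, Prop. 2.2.8, Lemma 3.2.7 and proof of Thm. 2.2.10 (arXiv:1202.6340 p. 16–18)] [cite: GreenbergLNM1716, §2–§3] -/
theorem finite_and_natCard_setOf_oneCocycleClass_quotient_torsionFilAt_principal_le_pow_of_hasMultiplicativeReductionAt_three
    (hpv : ((3 : ℕ) : 𝓞 K) ∈ v.asIdeal) (hmult : V.HasMultiplicativeReductionAt v) {k : ℕ}
    (hk : 1 ≤ k) (σ₀ : absoluteGaloisGroup (v.adicCompletion K)) {s : ℕ}
    (hσ : (κ (absGaloisRestrict K (v.adicCompletion K) σ₀)).toAdd = ((3 ^ s : ℕ) : ℤ_[3])) (hms : 3 ^ s < m) :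
    Finite {x : galoisCohomology ((GaloisRep.toLocal v (κ.eisensteinTwist (V.torsionGaloisModule (((3 : ℕ) : ℤ) ^ k)) hm k)).quotient
        ((V.ordinaryFiltrationAt v t ht).twistedFil k) ((V.ordinaryFiltrationAt v t ht).twistedFil_le_comap hm k)) 1 //
        ∃ φ : contOneCocycles ((GaloisRep.toLocal v (κ.eisensteinTwist (V.torsionGaloisModule (((3 : ℕ) : ℤ) ^ k)) hm k)).quotient
            ((V.ordinaryFiltrationAt v t ht).twistedFil k) ((V.ordinaryFiltrationAt v t ht).twistedFil_le_comap hm k)).toTopRep,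
          oneCocycleClass _ φ = x ∧
            ∃ q₀ : EisensteinCoeff.Twisted 3 m k (geomTorsion V (((3 : ℕ) : ℤ) ^ k)) ⧸ (V.ordinaryFiltrationAt v t ht).twistedFil k,
              ∀ σ : absoluteGaloisGroup (v.adicCompletion K), absGaloisRestrict K (v.adicCompletion K) σ ∈ κ.kerSubgroup →
                φ.1 σ = (GaloisRep.toLocal v (κ.eisensteinTwist (V.torsionGaloisModule (((3 : ℕ) : ℤ) ^ k)) hm k)).quotient
                  ((V.ordinaryFiltrationAt v t ht).twistedFil k) ((V.ordinaryFiltrationAt v t ht).twistedFil_le_comap hm k)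
                  σ q₀ - q₀} ∧
      Nat.card {x : galoisCohomology ((GaloisRep.toLocal v (κ.eisensteinTwist (V.torsionGaloisModule (((3 : ℕ) : ℤ) ^ k)) hm k)).quotient
          ((V.ordinaryFiltrationAt v t ht).twistedFil k) ((V.ordinaryFiltrationAt v t ht).twistedFil_le_comap hm k)) 1 //
          ∃ φ : contOneCocycles ((GaloisRep.toLocal v (κ.eisensteinTwist (V.torsionGaloisModule (((3 : ℕ) : ℤ) ^ k)) hm k)).quotient
              ((V.ordinaryFiltrationAt v t ht).twistedFil k) ((V.ordinaryFiltrationAt v t ht).twistedFil_le_comap hm k)).toTopRep,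
            oneCocycleClass _ φ = x ∧
              ∃ q₀ : EisensteinCoeff.Twisted 3 m k (geomTorsion V (((3 : ℕ) : ℤ) ^ k)) ⧸ (V.ordinaryFiltrationAt v t ht).twistedFil k,
                ∀ σ : absoluteGaloisGroup (v.adicCompletion K), absGaloisRestrict K (v.adicCompletion K) σ ∈ κ.kerSubgroup →
                  φ.1 σ = (GaloisRep.toLocal v (κ.eisensteinTwist (V.torsionGaloisModule (((3 : ℕ) : ℤ) ^ k)) hm k)).quotient
                    ((V.ordinaryFiltrationAt v t ht).twistedFil k) ((V.ordinaryFiltrationAt v t ht).twistedFil_le_comap hm k)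
                    σ q₀ - q₀} ≤ 3 ^ (3 ^ s) := by
  haveI : NeZero (3 ^ k) := ⟨pow_ne_zero k Nat.prime_three.ne_zero⟩
  haveI : Finite (geomTorsion V (((3 : ℕ) : ℤ) ^ k)) :=
    finite_torsionPoints_holds V (AlgebraicClosure K) (pow_ne_zero k (Nat.cast_ne_zero.mpr Nat.prime_three.ne_zero))
  have hdata := V.exists_int_scalar_torsionFilAt_of_hasMultiplicativeReductionAt_three v hpv hmult hk σ₀
  obtain ⟨n₀, Q₀, hn₀, hσ₀, hQ₀⟩ := hdata
  have hmain := (V.ordinaryFiltrationAt v t ht).finite_and_natCard_setOf_oneCocycleClass_quotient_twistedFil_principal_le_pow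
    κ hm k σ₀ n₀ hn₀ hσ₀ Q₀ hQ₀ hσ hms
  exact hmain

end WeierstrassCurve

end
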